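import Summits.NavierStokesRegularity.NavierStokesRegularity.Theorems.SoloRefuteSchatz2025WindJetKernel

/-!
# C171 `Schatz2025` — wind-jet refutation of the local face `Step_M1_local` — part 2/6: the wind-jet is a suitable weak solution

Cell `ns-claims` (D-0090), row C171 `Schatz2025` (locator =
the LANDED skeleton `Literature.Claims.NS.Schatz2025`, text of record as cited in its module docstring). Records-grade ADDENDUM
object of ns-claims-refuter-5 g5 (chair 2026-08-27T18:19Z: records only; row #155 adjudicated at the consumed
head `Step_M1`). Target of the chain: the RECORDED local face
`Literature.Claims.NS.Schatz2025.Step_M1_local` (skeleton l.182; (M.1) p.42 l.2, l.36–38 «F(θr) ≤ κ F(r) + C θ³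
for every suitable weak solution on Q_r(z0)», constants `θ ∈ (0,1/8)`, `κ ∈ (0,1)`, `C ≥ 0` FIRST, then every
open region, every suitable weak solution, every centre and radius with `Q_{2r}(z0) ⊆ Q`).
Main theorem (last file of the chain): `Summit.NavierStokesRegularity.NavierStokesRegularity.Theorems.Schatz2025.not_Step_M1_local`.

THIS FILE (2/6): the object. `windJet M a U` = the 2½-D flow with constant planar wind `windV U = U e₀`
and vertical component `jet M a U t y = M · K_{t+a}(y − tU e₀)` (a heat-kernel column born at time `−a`,
advected by the wind), zero pressure. It is a classical NS solution on the region `offBirth a U` (off the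
birth point) and, for `2 ≤ aU`, a SUITABLE WEAK SOLUTION on the parabolic cylinder `Q₂(0)`
(`windJet_suitable`, via the tree's `TwoAndAHalfD` / `ClassicalSuitableRegionEnergy` machinery). Also the
definition of the column functional `Gcol a U t η = K⁺_{t+a}(η − tU e₀)³` used from part 3 on (all `def`s of the
chain live in parts 1–2).

WHAT THIS IS NOT: not a claim about NS regularity or blow-up; not a claim about any author beyond the typed
locator.
-/

-- lint debt (cell convention, SoloRefute files): the Theorems namespace repeats `NavierStokesRegularity`.
set_option linter.dupNamespace false

noncomputable section

open Set Function MeasureTheory Filter TopologicalSpace Metric Real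
open scoped Topology ContDiff ENNReal RealInnerProductSpace Laplacian

namespace Summit.NavierStokesRegularity.NavierStokesRegularity.Theorems.Schatz2025

open Literature.Analysis.FluidPDE Literature.Analysis.UnboundedOperators

local notation "ℝ³" => EuclideanSpace ℝ (Fin 3)
local notation "ℝ²" => EuclideanSpace ℝ (Fin 2)

/-! ## The field -/

/-- The wind `U e₀` in the horizontal plane. [folklore] -/
def windV (U : ℝ) : ℝ² := U • EuclideanSpace.single 0 1

/-- The jet profile in the wind frame: the zero-extended planar heat kernel of age `t + a` (born at time
`-a`), centred on the moving axis `t • windV U`, with amplitude `M`. [folklore] -/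
def jet (M a U : ℝ) (t : ℝ) (y : ℝ²) : ℝ :=
  M * heatKernelFwd 1 (t + a, y - t • windV U)

/-- The jet profile in its rest frame. [folklore] -/
def jetRest (M a : ℝ) (t : ℝ) (y : ℝ²) : ℝ :=
  M * heatKernelFwd 1 (t + a, y)

/-- **The wind-jet**: uniform wind `ι(U e₀)` plus the vertical jet `jet • e_z` (a 2½-D field). [folklore] -/
def windJet (M a U : ℝ) : ℝ → ℝ³ → ℝ³ :=
  TwoAndAHalfD.velocity (fun _ _ => windV U) (jet M a U)

/-- Components of the wind-jet: planar part `windV U`, vertical part `jet M a U t (projXY x)`. [folklore] -/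
theorem windJet_apply (M a U t : ℝ) (x : ℝ³) :
    windJet M a U t x = embedXY (windV U) + jet M a U t (projXY x) • eZ := rfl

/-- `‖windV U‖ = |U|`. [folklore] -/
theorem norm_windV (U : ℝ) : ‖windV U‖ = |U| := by
  simp [windV, norm_smul]

/-! ## The rest-frame jet solves the heat equation after birth -/

/-- After birth (`0 < t + a`) the rest-frame jet is `M` times the planar heat kernel at time `t + a`. [folklore] -/
theorem jetRest_eq_of_pos {M a t : ℝ} (ht : 0 < t + a) (y : ℝ²) :
    jetRest M a t y = M * heatKernel (t + a) y := by
  rw [jetRest, heatKernelFwd_of_pos 1 (by exact ht), one_mul]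

/-- After birth the jet is `M · K_{t+a}(y − tU e₀)`. [folklore] -/
theorem jet_eq_of_pos {M a U t : ℝ} (ht : 0 < t + a) (y : ℝ²) :
    jet M a U t y = M * heatKernel (t + a) (y - t • windV U) := by
  rw [jet, heatKernelFwd_of_pos 1 (by exact ht), one_mul]

/-- Before birth (`t + a ≤ 0`) the jet vanishes. [folklore] -/
theorem jet_eq_of_nonpos {M a U t : ℝ} (ht : t + a ≤ 0) (y : ℝ²) : jet M a U t y = 0 := by
  rw [jet, heatKernelFwd_of_nonpos 1 (by exact ht), mul_zero]

/-- Before birth the wind-jet is the constant wind. [folklore] -/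
theorem windJet_eq_of_nonpos {M a U t : ℝ} (ht : t + a ≤ 0) (x : ℝ³) :
    windJet M a U t x = embedXY (windV U) := by
  rw [windJet_apply, jet_eq_of_nonpos ht, zero_smul, add_zero]

/-- The rest-frame jet is space-time smooth on `(−a, ∞) × ℝ²`. [folklore] -/
theorem isSmoothSpaceTimeOn_jetRest (M a : ℝ) : IsSmoothSpaceTimeOn (Ioi (-a)) (jetRest M a) := by
  have hK := contDiffOn_uncurry_heatKernel (E := ℝ²) (m := ∞)
  have hΦ : ContDiff ℝ ∞ (fun q : ℝ × ℝ² => (q.1 + a, q.2)) :=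
    (contDiff_fst.add contDiff_const).prodMk contDiff_snd
  have hmaps : MapsTo (fun q : ℝ × ℝ² => (q.1 + a, q.2)) (Ioi (-a) ×ˢ univ) (Ioi 0 ×ˢ univ) := by
    rintro ⟨t, y⟩ ⟨ht, -⟩
    exact ⟨by simp only [mem_Ioi] at ht ⊢; linarith, mem_univ _⟩
  have h := (hK.comp hΦ.contDiffOn hmaps).const_smul M
  refine h.congr ?_
  rintro ⟨t, y⟩ ⟨ht, -⟩
  have ht' : 0 < t + a := by simp only [mem_Ioi] at ht; linarith
  simp [uncurry, jetRest_eq_of_pos ht', smul_eq_mul]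

/-- `finrank ℝ ℝ² = 2`. [folklore] -/
theorem finrank_R2 : (Module.finrank ℝ ℝ² : ℝ) = 2 := by simp

/-- The heat equation for the rest-frame jet, in the form consumed by Prop. 2.7. [folklore] -/
theorem jetRest_heat {M a t : ℝ} (ht : t ∈ Ioi (-a)) (y : ℝ²) :
    timeDerivWithin (Ioi (-a)) (jetRest M a) t y + convect ((0 : ℝ → ℝ² → ℝ²) t) (jetRest M a t) y =
      1 * (Δ (jetRest M a t)) y := by
  have ht' : 0 < t + a := by simp only [mem_Ioi] at ht; linarith
  have hc : convect ((0 : ℝ → ℝ² → ℝ²) t) (jetRest M a t) y = 0 := by simp [convect]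
  -- time derivative
  have hev : (fun s => jetRest M a s y) =ᶠ[𝓝 t] fun s => M * heatKernel (s + a) y := by
    have : ∀ᶠ s in 𝓝 t, 0 < s + a :=
      (continuous_id.add continuous_const).continuousAt.eventually (Ioi_mem_nhds ht')
    exact this.mono fun s hs => jetRest_eq_of_pos hs y
  have hder : HasDerivAt (fun s => M * heatKernel (s + a) y)
      (M * ((‖y‖ ^ 2 / (4 * (t + a) ^ 2) - (Module.finrank ℝ ℝ² : ℝ) / (2 * (t + a))) *
        heatKernel (t + a) y)) t := by
    have h1 := hasDerivAt_heatKernel_time (E := ℝ²) ht' y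
    have h2 : HasDerivAt (fun s : ℝ => s + a) 1 t := (hasDerivAt_id t).add_const a
    have := (h1.comp t h2)
    simpa using this.const_mul M
  have htd : timeDerivWithin (Ioi (-a)) (jetRest M a) t y =
      M * ((‖y‖ ^ 2 / (4 * (t + a) ^ 2) - (Module.finrank ℝ ℝ² : ℝ) / (2 * (t + a))) *
        heatKernel (t + a) y) := by
    rw [timeDerivWithin_apply, derivWithin_of_isOpen isOpen_Ioi ht, hev.deriv_eq, hder.deriv]
  -- Laplacian
  have hfun : jetRest M a t = M • heatKernel (t + a) := by
    funext z; simp [jetRest_eq_of_pos ht', smul_eq_mul]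
  have hΔ : (Δ (jetRest M a t)) y =
      M * ((‖y‖ ^ 2 / (4 * (t + a) ^ 2) - (Module.finrank ℝ ℝ² : ℝ) / (2 * (t + a))) *
        heatKernel (t + a) y) := by
    rw [hfun, InnerProductSpace.laplacian_smul M ((Scheffer.contDiff_heatKernel (t + a)).contDiffAt),
      Scheffer.laplacian_heatKernel, smul_eq_mul]
  rw [hc, add_zero, htd, hΔ, one_mul]

/-- The rest-frame wind-less jet `jetRest • e_z` is a classical solution after birth (Prop. 2.7 over the
rest state). [folklore] -/
theorem rest_solution (M a : ℝ) :
    IsClassicalNSSolutionOn (Ioi (-a)) 1 0 (TwoAndAHalfD.velocity 0 (jetRest M a))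
      (TwoAndAHalfD.pressure 0) :=
  TwoAndAHalfD.isClassicalNSSolutionOn_twoAndAHalfD (uniqueDiffOn_Ioi (-a))
    (isClassicalNSSolutionOn_zero (Ioi (-a)) 1) (isSmoothSpaceTimeOn_jetRest M a)
    (fun _ ht y => jetRest_heat ht y)

/-- **The wind-jet is a classical solution after birth** (Galilean boost of the rest-frame jet by the
wind). [folklore] -/
theorem windJet_solution_after (M a U : ℝ) :
    IsClassicalNSSolutionOn (Ioi (-a)) 1 0 (windJet M a U) (fun _ _ => 0) := by
  have h := (rest_solution M a).galileanBoost_const (uniqueDiffOn_Ioi (-a)) (-embedXY (windV U))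
  have hu : (fun t y => TwoAndAHalfD.velocity 0 (jetRest M a) t (y + t • -embedXY (windV U)) -
      -embedXY (windV U)) = windJet M a U := by
    funext t y
    simp only [TwoAndAHalfD.velocity_apply, windJet_apply, jet, jetRest, Pi.zero_apply, map_zero,
      zero_add, sub_neg_eq_add, map_add, map_smul, map_neg, projXY_embedXY, smul_neg]
    rw [add_comm, sub_eq_add_neg]
  have hp : (fun t y => TwoAndAHalfD.pressure (0 : ℝ → ℝ² → ℝ) t (y + t • -embedXY (windV U))) =
      fun _ _ => (0 : ℝ) := by
    funext t y; simp
  have hf : (fun t y => (0 : ℝ → ℝ³ → ℝ³) t (y + t • -embedXY (windV U))) = 0 := by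
    funext t y; simp
  rw [hu, hp, hf] at h
  exact h

/-! ## Smoothness off the birth line and the region predicate -/

/-- The zero-extended heat kernel is smooth off the space-time origin. [folklore] -/
theorem contDiffOn_heatKernelFwd_off_origin {n : ℕ∞} :
    ContDiffOn ℝ n (heatKernelFwd (E := ℝ²) 1) {p : ℝ × ℝ² | p.1 ≠ 0 ∨ p.2 ≠ 0} := by
  rintro p (hp | hp)
  · rcases lt_or_gt_of_ne hp with hneg | hpos
    · -- locally zero
      have hev : heatKernelFwd (E := ℝ²) 1 =ᶠ[𝓝 p] fun _ => 0 := by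
        have : ∀ᶠ q : ℝ × ℝ² in 𝓝 p, q.1 < 0 := continuous_fst.continuousAt.eventually (Iio_mem_nhds hneg)
        exact this.mono fun q hq => heatKernelFwd_of_nonpos 1 hq.le
      exact (contDiffAt_const.congr_of_eventuallyEq hev).contDiffWithinAt
    · have hK := contDiffOn_uncurry_heatKernel (E := ℝ²) (m := n)
      have h1 : ContDiffAt ℝ n (fun q : ℝ × ℝ² => heatKernel q.1 q.2) p :=
        hK.contDiffAt ((isOpen_Ioi.prod isOpen_univ).mem_nhds ⟨hpos, mem_univ _⟩)
      have hev : heatKernelFwd (E := ℝ²) 1 =ᶠ[𝓝 p] fun q => heatKernel q.1 q.2 := by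
        have : ∀ᶠ q : ℝ × ℝ² in 𝓝 p, 0 < q.1 := continuous_fst.continuousAt.eventually (Ioi_mem_nhds hpos)
        exact this.mono fun q hq => by rw [heatKernelFwd_of_pos 1 hq, one_mul]
      exact (h1.congr_of_eventuallyEq hev).contDiffWithinAt
  · exact ((contDiffOn_heatKernelFwd (E := ℝ²) one_pos).contDiffAt
      ((isOpen_ne_fun continuous_snd continuous_const).mem_nhds hp)).contDiffWithinAt

/-- The open complement of the birth line `{t = -a, x̃ = -a V}`. [folklore] -/
def offBirth (a U : ℝ) : Set (ℝ × ℝ³) :=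
  {q | q.1 + a ≠ 0 ∨ projXY q.2 - q.1 • windV U ≠ 0}

/-- The region off the birth point is open. [folklore] -/
theorem isOpen_offBirth (a U : ℝ) : IsOpen (offBirth a U) := by
  have h1 : Continuous fun q : ℝ × ℝ³ => q.1 + a := continuous_fst.add continuous_const
  have h2 : Continuous fun q : ℝ × ℝ³ => projXY q.2 - q.1 • windV U :=
    (projXY.continuous.comp continuous_snd).sub (continuous_fst.smul continuous_const)
  exact (isOpen_ne_fun h1 continuous_const).union (isOpen_ne_fun h2 continuous_const)

/-- Joint smoothness of the wind-jet off the birth line. [folklore] -/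
theorem contDiffOn_windJet (M a U : ℝ) {n : ℕ∞} :
    ContDiffOn ℝ n (uncurry (windJet M a U)) (offBirth a U) := by
  have hΦ : ContDiff ℝ n (fun q : ℝ × ℝ³ => (q.1 + a, projXY q.2 - q.1 • windV U)) :=
    (contDiff_fst.add contDiff_const).prodMk
      ((projXY.contDiff.comp contDiff_snd).sub (contDiff_fst.smul contDiff_const))
  have hmaps : MapsTo (fun q : ℝ × ℝ³ => (q.1 + a, projXY q.2 - q.1 • windV U)) (offBirth a U)
      {p : ℝ × ℝ² | p.1 ≠ 0 ∨ p.2 ≠ 0} := fun q hq => hq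
  have hK := (contDiffOn_heatKernelFwd_off_origin (n := n)).comp hΦ.contDiffOn hmaps
  have h : ContDiffOn ℝ n
      (fun q : ℝ × ℝ³ => embedXY (windV U) + (M * heatKernelFwd 1 (q.1 + a, projXY q.2 - q.1 • windV U)) • eZ)
      (offBirth a U) :=
    contDiffOn_const.add ((contDiffOn_const.mul hK).smul contDiffOn_const)
  exact h.congr fun q _ => by simp [uncurry, windJet_apply, jet]

/-- For `t ≤ -a` the wind-jet is the bare wind, so its time derivative vanishes there wherever it is
differentiable (one-sided uniqueness on `(-∞, t]`). [folklore] -/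
theorem deriv_windJet_of_nonpos {M a U t : ℝ} (ht : t + a ≤ 0) (x : ℝ³)
    (hd : DifferentiableAt ℝ (fun s => windJet M a U s x) t) :
    deriv (fun s => windJet M a U s x) t = 0 := by
  have h1 : HasDerivWithinAt (fun s => windJet M a U s x) (deriv (fun s => windJet M a U s x) t)
      (Iic t) t := hd.hasDerivAt.hasDerivWithinAt
  have h2 : HasDerivWithinAt (fun s => windJet M a U s x) 0 (Iic t) t := by
    have hc : HasDerivWithinAt (fun _ : ℝ => embedXY (windV U)) 0 (Iic t) t :=
      hasDerivWithinAt_const t (Iic t) _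
    refine hc.congr (fun s hs => ?_) ?_
    · exact windJet_eq_of_nonpos (by simp only [mem_Iic] at hs; linarith) x
    · exact windJet_eq_of_nonpos ht x
  exact (uniqueDiffWithinAt_Iic t).eq_deriv _ h1 h2

/-- **The wind-jet is a classical solution of NS (ν = 1, f = 0, p = 0) off the birth line.** [folklore] -/
theorem windJet_region (M a U : ℝ) :
    IsClassicalNSSolutionOnRegion (offBirth a U) 1 0 (windJet M a U) (fun _ _ => 0) := by
  rw [isClassicalNSSolutionOnRegion_iff_of_isOpen (isOpen_offBirth a U)]
  have hafter := (isClassicalNSSolutionOnRegion_iff_of_isOpen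
    ((isOpen_Ioi (a := -a)).prod isOpen_univ)).1 (windJet_solution_after M a U).onRegion
  obtain ⟨-, -, hmom, hdiv⟩ := hafter
  refine ⟨contDiffOn_windJet M a U, contDiffOn_const, fun t x hq => ?_, fun t x hq => ?_⟩
  · rcases lt_or_ge 0 (t + a) with hpos | hle
    · exact hmom t x ⟨by simp only [mem_Ioi]; linarith, mem_univ _⟩
    · -- before (or at) birth, off the birth point: everything vanishes
      have hu : windJet M a U t = fun _ => embedXY (windV U) := funext (windJet_eq_of_nonpos hle)
      have hd : DifferentiableAt ℝ (fun s => windJet M a U s x) t := by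
        have h1 : ContDiffAt ℝ 1 (uncurry (windJet M a U)) (t, x) :=
          (contDiffOn_windJet M a U (n := 1)).contDiffAt ((isOpen_offBirth a U).mem_nhds hq)
        have h2 : DifferentiableAt ℝ (uncurry (windJet M a U)) (t, x) := h1.differentiableAt one_ne_zero
        have h3 : DifferentiableAt ℝ (fun s : ℝ => (s, x)) t :=
          differentiableAt_id.prodMk (differentiableAt_const x)
        have h4 : DifferentiableAt ℝ (uncurry (windJet M a U) ∘ fun s : ℝ => (s, x)) t := h2.comp t h3
        exact h4
      rw [deriv_windJet_of_nonpos hle x hd, hu]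
      simp [convect]
  · rcases lt_or_ge 0 (t + a) with hpos | hle
    · exact hdiv t x ⟨by simp only [mem_Ioi]; linarith, mem_univ _⟩
    · have hu : windJet M a U t = fun _ => embedXY (windV U) := funext (windJet_eq_of_nonpos hle)
      rw [hu]
      simp [VectorCalculus.divergence]

/-- ‖x̃‖ ≤ ‖x‖. [folklore] -/
theorem norm_projXY_le (x : ℝ³) : ‖projXY x‖ ≤ ‖x‖ := by
  simpa using projXY.le_of_opNorm_le norm_projXY_clm_le x

/-- **The wind-jet is a suitable weak solution on `Q₂(0,0)`** as soon as the birth point `-a V` lies at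
horizontal distance `a U ≥ 2` from the axis (classical ⇒ suitable, tree bridge). [folklore] -/
theorem windJet_suitable (M : ℝ) {a U : ℝ} (haU : 2 ≤ a * U) :
    IsSuitableWeakSolutionOn (parabolicCylinderOpens 2 (0 : ℝ × ℝ³)) 1 0 (windJet M a U)
      (fun _ _ => 0) := by
  refine (windJet_region M a U).isSuitableWeakSolutionOn_of_subset one_pos ?_
  intro q hq
  rw [coe_parabolicCylinderOpens, mem_parabolicCylinder] at hq
  by_contra hnot
  simp only [offBirth, mem_setOf_eq, not_or, not_not] at hnot
  obtain ⟨h1, h2⟩ := hnot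
  have ht : q.1 = -a := by linarith
  have hx : projXY q.2 = q.1 • windV U := sub_eq_zero.1 h2
  have hn : ‖projXY q.2‖ = |a * U| := by
    rw [hx, ht, norm_smul, norm_windV, Real.norm_eq_abs, abs_neg, ← abs_mul]
  have hlt : ‖q.2‖ < 2 := by simpa using hq.2
  have : (2 : ℝ) ≤ ‖projXY q.2‖ := by rw [hn]; exact haU.trans (le_abs_self _)
  linarith [norm_projXY_le q.2]

/-- `Gcol a U t y = K⁺_{t+a}(y − t U e₀)³ ∈ [0,∞]` (the cube of the zero-extended planar kernel read at the
moving centre). [folklore] -/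
def Gcol (a U : ℝ) (t : ℝ) (y : ℝ²) : ℝ≥0∞ :=
  ENNReal.ofReal (heatKernelFwd 1 (t + a, y - t • windV U) ^ 3)

end Summit.NavierStokesRegularity.NavierStokesRegularity.Theorems.Schatz2025
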